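import Summits.Ventures.WeilGRH.UniformConductorFloorCoprimeData57Log9
import Summits.Ventures.WeilGRH.UniformConductorFloorJointFloorsLog8
import Summits.Ventures.WeilGRH.UniformConductorFloorJointFloorsLog9
import Summits.Ventures.WeilGRH.UniformConductorFloorCellsOne
import Summits.Ventures.WeilGRH.UniformConductorFloorRungs
import HarnessLib

/-!
# GRH arm (rh-explicit, venture WeilGRH): divisibility floors at `t = log 3`, levels `5, 7, 10, 21` — the transcendental inputs

Cell `rh-explicit`, WEIL TRACK — GRH ARM (weil-grh-1, gen9).  For the four EVEN joint cell certificates of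
`UniformConductorFloorCoprimeData57Log9.lean` (level `m ∈ {5, 7, 10, 21}`, grid `R = 320`, `J = 352`, prime powers `n ≤ 9`): the weight bounds on
the `n` PRIME TO `m` (`UniformFloor.wbar7_ge`, `vonMangoldt_eight_div_sqrt_le`, `vonMangoldt_nine_div_sqrt_le`; the other weights are `0`) and the four budget inequalities
`log π − ψ₀ − Clow/D + RHO/D ≤ log Q₀` (`certEvenDvd5Log9` → Q₀ = 90; `certEvenDvd7Log9` → Q₀ = 112; `certEvenDvd10Log9` → Q₀ = 40; `certEvenDvd21Log9` → Q₀ = 63; elementary logarithm bounds from `log 2`, `log 3` inline).  The window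
`log 3 ≤ 352 log(320/319)` is the tree's `UniformFloor.log_three_le_t`.  Consumed by `UniformConductorFloorCoprimeFloors57Log9.lean`.
No definitions; no named facts; standard axioms. [folklore]
-/

noncomputable section

open Real Set
open scoped ArithmeticFunction.vonMangoldt

namespace Summit.Ventures.WeilGRH

open Literature.NumberTheory.LFunctions

namespace UniformFloor

/-! ## The weights -/

/-- The weights of `certEvenDvd5Log9` dominate `Λ(n)/√n` on the `n ≤ 9` prime to `5`; the other weights are `0`. [folklore] -/
theorem certEvenDvd5Log9_hw : ∀ n ∈ Finset.range (certEvenDvd5Log9.N + 1),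
    (if n.Coprime 5 then (Λ n : ℝ) / Real.sqrt n else 0) ≤ certEvenDvd5Log9.wbar n := by
  intro n hn
  have hnN : n < 10 := by simpa [show certEvenDvd5Log9.N = 9 from rfl] using Finset.mem_range.1 hn
  have h7 : ∀ k < 8, (Λ k : ℝ) / Real.sqrt k ≤ wbar7 k := fun k hk ↦
    wbar7_ge 7 le_rfl k (Finset.mem_range.2 (by omega))
  unfold JointCert.wbar
  rw [show certEvenDvd5Log9.D = 1048576 from rfl]
  interval_cases n
  · rw [if_neg (by decide), show certEvenDvd5Log9.weights.getD 0 0 = 0 from rfl]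
    norm_num
  · rw [if_pos (by decide), show certEvenDvd5Log9.weights.getD 1 0 = 0 from rfl]
    exact (h7 1 (by norm_num)).trans (by norm_num [wbar7])
  · rw [if_pos (by decide), show certEvenDvd5Log9.weights.getD 2 0 = 513950 from rfl]
    exact (h7 2 (by norm_num)).trans (by norm_num [wbar7])
  · rw [if_pos (by decide), show certEvenDvd5Log9.weights.getD 3 0 = 665112 from rfl]
    exact (h7 3 (by norm_num)).trans (by norm_num [wbar7])
  · rw [if_pos (by decide), show certEvenDvd5Log9.weights.getD 4 0 = 363409 from rfl]
    exact (h7 4 (by norm_num)).trans (by norm_num [wbar7])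
  · rw [if_neg (by decide), show certEvenDvd5Log9.weights.getD 5 0 = 0 from rfl]
    norm_num
  · rw [if_pos (by decide), show certEvenDvd5Log9.weights.getD 6 0 = 0 from rfl]
    exact (h7 6 (by norm_num)).trans (by norm_num [wbar7])
  · rw [if_pos (by decide), show certEvenDvd5Log9.weights.getD 7 0 = 771213 from rfl]
    exact (h7 7 (by norm_num)).trans (by norm_num [wbar7])
  · rw [if_pos (by decide), show certEvenDvd5Log9.weights.getD 8 0 = 256975 from rfl]
    simpa using vonMangoldt_eight_div_sqrt_le
  · rw [if_pos (by decide), show certEvenDvd5Log9.weights.getD 9 0 = 383993 from rfl]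
    simpa using vonMangoldt_nine_div_sqrt_le

/-- The weights of `certEvenDvd7Log9` dominate `Λ(n)/√n` on the `n ≤ 9` prime to `7`; the other weights are `0`. [folklore] -/
theorem certEvenDvd7Log9_hw : ∀ n ∈ Finset.range (certEvenDvd7Log9.N + 1),
    (if n.Coprime 7 then (Λ n : ℝ) / Real.sqrt n else 0) ≤ certEvenDvd7Log9.wbar n := by
  intro n hn
  have hnN : n < 10 := by simpa [show certEvenDvd7Log9.N = 9 from rfl] using Finset.mem_range.1 hn
  have h7 : ∀ k < 8, (Λ k : ℝ) / Real.sqrt k ≤ wbar7 k := fun k hk ↦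
    wbar7_ge 7 le_rfl k (Finset.mem_range.2 (by omega))
  unfold JointCert.wbar
  rw [show certEvenDvd7Log9.D = 1048576 from rfl]
  interval_cases n
  · rw [if_neg (by decide), show certEvenDvd7Log9.weights.getD 0 0 = 0 from rfl]
    norm_num
  · rw [if_pos (by decide), show certEvenDvd7Log9.weights.getD 1 0 = 0 from rfl]
    exact (h7 1 (by norm_num)).trans (by norm_num [wbar7])
  · rw [if_pos (by decide), show certEvenDvd7Log9.weights.getD 2 0 = 513950 from rfl]
    exact (h7 2 (by norm_num)).trans (by norm_num [wbar7])
  · rw [if_pos (by decide), show certEvenDvd7Log9.weights.getD 3 0 = 665112 from rfl]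
    exact (h7 3 (by norm_num)).trans (by norm_num [wbar7])
  · rw [if_pos (by decide), show certEvenDvd7Log9.weights.getD 4 0 = 363409 from rfl]
    exact (h7 4 (by norm_num)).trans (by norm_num [wbar7])
  · rw [if_pos (by decide), show certEvenDvd7Log9.weights.getD 5 0 = 754726 from rfl]
    exact (h7 5 (by norm_num)).trans (by norm_num [wbar7])
  · rw [if_pos (by decide), show certEvenDvd7Log9.weights.getD 6 0 = 0 from rfl]
    exact (h7 6 (by norm_num)).trans (by norm_num [wbar7])
  · rw [if_neg (by decide), show certEvenDvd7Log9.weights.getD 7 0 = 0 from rfl]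
    norm_num
  · rw [if_pos (by decide), show certEvenDvd7Log9.weights.getD 8 0 = 256975 from rfl]
    simpa using vonMangoldt_eight_div_sqrt_le
  · rw [if_pos (by decide), show certEvenDvd7Log9.weights.getD 9 0 = 383993 from rfl]
    simpa using vonMangoldt_nine_div_sqrt_le

/-- The weights of `certEvenDvd10Log9` dominate `Λ(n)/√n` on the `n ≤ 9` prime to `10`; the other weights are `0`. [folklore] -/
theorem certEvenDvd10Log9_hw : ∀ n ∈ Finset.range (certEvenDvd10Log9.N + 1),
    (if n.Coprime 10 then (Λ n : ℝ) / Real.sqrt n else 0) ≤ certEvenDvd10Log9.wbar n := by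
  intro n hn
  have hnN : n < 10 := by simpa [show certEvenDvd10Log9.N = 9 from rfl] using Finset.mem_range.1 hn
  have h7 : ∀ k < 8, (Λ k : ℝ) / Real.sqrt k ≤ wbar7 k := fun k hk ↦
    wbar7_ge 7 le_rfl k (Finset.mem_range.2 (by omega))
  unfold JointCert.wbar
  rw [show certEvenDvd10Log9.D = 1048576 from rfl]
  interval_cases n
  · rw [if_neg (by decide), show certEvenDvd10Log9.weights.getD 0 0 = 0 from rfl]
    norm_num
  · rw [if_pos (by decide), show certEvenDvd10Log9.weights.getD 1 0 = 0 from rfl]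
    exact (h7 1 (by norm_num)).trans (by norm_num [wbar7])
  · rw [if_neg (by decide), show certEvenDvd10Log9.weights.getD 2 0 = 0 from rfl]
    norm_num
  · rw [if_pos (by decide), show certEvenDvd10Log9.weights.getD 3 0 = 665112 from rfl]
    exact (h7 3 (by norm_num)).trans (by norm_num [wbar7])
  · rw [if_neg (by decide), show certEvenDvd10Log9.weights.getD 4 0 = 0 from rfl]
    norm_num
  · rw [if_neg (by decide), show certEvenDvd10Log9.weights.getD 5 0 = 0 from rfl]
    norm_num
  · rw [if_neg (by decide), show certEvenDvd10Log9.weights.getD 6 0 = 0 from rfl]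
    norm_num
  · rw [if_pos (by decide), show certEvenDvd10Log9.weights.getD 7 0 = 771213 from rfl]
    exact (h7 7 (by norm_num)).trans (by norm_num [wbar7])
  · rw [if_neg (by decide), show certEvenDvd10Log9.weights.getD 8 0 = 0 from rfl]
    norm_num
  · rw [if_pos (by decide), show certEvenDvd10Log9.weights.getD 9 0 = 383993 from rfl]
    simpa using vonMangoldt_nine_div_sqrt_le

/-- The weights of `certEvenDvd21Log9` dominate `Λ(n)/√n` on the `n ≤ 9` prime to `21`; the other weights are `0`. [folklore] -/
theorem certEvenDvd21Log9_hw : ∀ n ∈ Finset.range (certEvenDvd21Log9.N + 1),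
    (if n.Coprime 21 then (Λ n : ℝ) / Real.sqrt n else 0) ≤ certEvenDvd21Log9.wbar n := by
  intro n hn
  have hnN : n < 10 := by simpa [show certEvenDvd21Log9.N = 9 from rfl] using Finset.mem_range.1 hn
  have h7 : ∀ k < 8, (Λ k : ℝ) / Real.sqrt k ≤ wbar7 k := fun k hk ↦
    wbar7_ge 7 le_rfl k (Finset.mem_range.2 (by omega))
  unfold JointCert.wbar
  rw [show certEvenDvd21Log9.D = 1048576 from rfl]
  interval_cases n
  · rw [if_neg (by decide), show certEvenDvd21Log9.weights.getD 0 0 = 0 from rfl]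
    norm_num
  · rw [if_pos (by decide), show certEvenDvd21Log9.weights.getD 1 0 = 0 from rfl]
    exact (h7 1 (by norm_num)).trans (by norm_num [wbar7])
  · rw [if_pos (by decide), show certEvenDvd21Log9.weights.getD 2 0 = 513950 from rfl]
    exact (h7 2 (by norm_num)).trans (by norm_num [wbar7])
  · rw [if_neg (by decide), show certEvenDvd21Log9.weights.getD 3 0 = 0 from rfl]
    norm_num
  · rw [if_pos (by decide), show certEvenDvd21Log9.weights.getD 4 0 = 363409 from rfl]
    exact (h7 4 (by norm_num)).trans (by norm_num [wbar7])
  · rw [if_pos (by decide), show certEvenDvd21Log9.weights.getD 5 0 = 754726 from rfl]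
    exact (h7 5 (by norm_num)).trans (by norm_num [wbar7])
  · rw [if_neg (by decide), show certEvenDvd21Log9.weights.getD 6 0 = 0 from rfl]
    norm_num
  · rw [if_neg (by decide), show certEvenDvd21Log9.weights.getD 7 0 = 0 from rfl]
    norm_num
  · rw [if_pos (by decide), show certEvenDvd21Log9.weights.getD 8 0 = 256975 from rfl]
    simpa using vonMangoldt_eight_div_sqrt_le
  · rw [if_neg (by decide), show certEvenDvd21Log9.weights.getD 9 0 = 0 from rfl]
    norm_num

/-! ## The budgets -/

/-- The budget of `certEvenDvd5Log9`: `log π − (-4.22745354) − Clow/D + RHO/D = 4.493846 ≤ log 90` (`log 90 ≥ 5 log 2 + 1 log 3 − (96 − 90)/90 = 4.497682`). [folklore] -/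
theorem certEvenDvd5Log9_budget :
    Real.log Real.pi - (-4.22745354) - (certEvenDvd5Log9.Clow : ℝ) / certEvenDvd5Log9.D + (certEvenDvd5Log9.RHO : ℝ) / certEvenDvd5Log9.D ≤
      Real.log (90 : ℕ) := by
  have hπ := Literature.Analysis.SpecialFunctions.Real.log_pi_le
  have h2 := Real.log_two_gt_d9
  have h3 := Real.log_three_gt_d9
  have hl : Real.log ((96 : ℝ) / 90) ≤ 96 / 90 - 1 := Real.log_le_sub_one_of_pos (by norm_num)
  have hS : Real.log (96 : ℝ) = 5 * Real.log 2 + 1 * Real.log 3 := by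
    rw [show (96 : ℝ) = 2 ^ 5 * 3 ^ 1 by norm_num, Real.log_mul (by norm_num) (by norm_num), Real.log_pow, Real.log_pow]
    push_cast
    ring
  rw [Real.log_div (by norm_num) (by norm_num), hS] at hl
  rw [show certEvenDvd5Log9.Clow = 7676641 from rfl, show certEvenDvd5Log9.D = 1048576 from rfl,
    show certEvenDvd5Log9.RHO = 6755637 from rfl]
  push_cast at *
  linarith

/-- The budget of `certEvenDvd7Log9`: `log π − (-4.22745354) − Clow/D + RHO/D = 4.705139 ≤ log 112` (`log 112 ≥ 7 log 2 + 0 log 3 − (128 − 112)/112 = 4.709173`). [folklore] -/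
theorem certEvenDvd7Log9_budget :
    Real.log Real.pi - (-4.22745354) - (certEvenDvd7Log9.Clow : ℝ) / certEvenDvd7Log9.D + (certEvenDvd7Log9.RHO : ℝ) / certEvenDvd7Log9.D ≤
      Real.log (112 : ℕ) := by
  have hπ := Literature.Analysis.SpecialFunctions.Real.log_pi_le
  have h2 := Real.log_two_gt_d9
  have h3 := Real.log_three_gt_d9
  have hl : Real.log ((128 : ℝ) / 112) ≤ 128 / 112 - 1 := Real.log_le_sub_one_of_pos (by norm_num)
  have hS : Real.log (128 : ℝ) = 7 * Real.log 2 + 0 * Real.log 3 := by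
    rw [show (128 : ℝ) = 2 ^ 7 * 3 ^ 0 by norm_num, Real.log_mul (by norm_num) (by norm_num), Real.log_pow, Real.log_pow]
    push_cast
    ring
  rw [Real.log_div (by norm_num) (by norm_num), hS] at hl
  rw [show certEvenDvd7Log9.Clow = 7676641 from rfl, show certEvenDvd7Log9.D = 1048576 from rfl,
    show certEvenDvd7Log9.RHO = 6977194 from rfl]
  push_cast at *
  linarith

/-- The budget of `certEvenDvd10Log9`: `log π − (-4.22745354) − Clow/D + RHO/D = 3.526571 ≤ log 40` (`log 40 ≥ 4 log 2 + 1 log 3 − (48 − 40)/40 = 3.671201`). [folklore] -/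
theorem certEvenDvd10Log9_budget :
    Real.log Real.pi - (-4.22745354) - (certEvenDvd10Log9.Clow : ℝ) / certEvenDvd10Log9.D + (certEvenDvd10Log9.RHO : ℝ) / certEvenDvd10Log9.D ≤
      Real.log (40 : ℕ) := by
  have hπ := Literature.Analysis.SpecialFunctions.Real.log_pi_le
  have h2 := Real.log_two_gt_d9
  have h3 := Real.log_three_gt_d9
  have hl : Real.log ((48 : ℝ) / 40) ≤ 48 / 40 - 1 := Real.log_le_sub_one_of_pos (by norm_num)
  have hS : Real.log (48 : ℝ) = 4 * Real.log 2 + 1 * Real.log 3 := by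
    rw [show (48 : ℝ) = 2 ^ 4 * 3 ^ 1 by norm_num, Real.log_mul (by norm_num) (by norm_num), Real.log_pow, Real.log_pow]
    push_cast
    ring
  rw [Real.log_div (by norm_num) (by norm_num), hS] at hl
  rw [show certEvenDvd10Log9.Clow = 7676641 from rfl, show certEvenDvd10Log9.D = 1048576 from rfl,
    show certEvenDvd10Log9.RHO = 5741376 from rfl]
  push_cast at *
  linarith

/-- The budget of `certEvenDvd21Log9`: `log π − (-4.22745354) − Clow/D + RHO/D = 4.064166 ≤ log 63` (`log 63 ≥ 6 log 2 + 0 log 3 − (64 − 63)/63 = 4.143010`). [folklore] -/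
theorem certEvenDvd21Log9_budget :
    Real.log Real.pi - (-4.22745354) - (certEvenDvd21Log9.Clow : ℝ) / certEvenDvd21Log9.D + (certEvenDvd21Log9.RHO : ℝ) / certEvenDvd21Log9.D ≤
      Real.log (63 : ℕ) := by
  have hπ := Literature.Analysis.SpecialFunctions.Real.log_pi_le
  have h2 := Real.log_two_gt_d9
  have h3 := Real.log_three_gt_d9
  have hl : Real.log ((64 : ℝ) / 63) ≤ 64 / 63 - 1 := Real.log_le_sub_one_of_pos (by norm_num)
  have hS : Real.log (64 : ℝ) = 6 * Real.log 2 + 0 * Real.log 3 := by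
    rw [show (64 : ℝ) = 2 ^ 6 * 3 ^ 0 by norm_num, Real.log_mul (by norm_num) (by norm_num), Real.log_pow, Real.log_pow]
    push_cast
    ring
  rw [Real.log_div (by norm_num) (by norm_num), hS] at hl
  rw [show certEvenDvd21Log9.Clow = 7676641 from rfl, show certEvenDvd21Log9.D = 1048576 from rfl,
    show certEvenDvd21Log9.RHO = 6305085 from rfl]
  push_cast at *
  linarith
end UniformFloor

end Summit.Ventures.WeilGRH

end
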